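import Summits.CriticalPhenomena.Ising3DConformalLimit.Theses.HyperoctahedralRP
import Summits.CriticalPhenomena.Ising3DConformalLimit.Theorems.MoebiusLimitExists.Negative.FreeTranslations
import Summits.CriticalPhenomena.Ising3DConformalLimit.Theorems.MoebiusLimitExists.Negative.ScaleRedundant
import Summits.CriticalPhenomena.Ising3DConformalLimit.Theorems.MoebiusLimitExists.Negative.TwoPointPositivity
import Summits.CriticalPhenomena.Ising3DConformalLimit.Theorems.MoebiusLimitExists.Negative.MeshContinuity
import Literature.Probability.LatticeModels.PointwiseScalingLimitScale
import Literature.Probability.LatticeModels.CriticalUrsellFourSign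
import HarnessLib

/-!
# `ExistsScaleCovariantLimit` (item stmt-CriticalPhenomena-1981) is PURE EXISTENCE

Structural / negative knowledge about the crux
`Summit.CriticalPhenomena.Ising3DConformalLimit.Theses.HyperoctahedralRP.ExistsScaleCovariantLimit`
(shared item 1981: `PlanarCornerRotations`, `PositivityBegetsConformality`, `ConformalPoissonDevice`, …;
target of route `MonotoneRG`), standing crux disprover, cycle 2 (D-0016); THEOREM-ONLY.

* `iff_limit_nondeg`, `iff_pure_existence`: the crux is equivalent to
  `∃ ρ S, HasPointwiseScalingLimit (criticalCorr 3) ρ S ∧ ∃ x ∈ NonCoincident 3 2, S 2 x ≠ 0` —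
  the clauses `ρ > 0`, `0 < Δ`, normalisation, `IsTranslationInvariant`, `IsScaleCovariant Δ` and
  non-degeneracy beyond ONE pair are all consequences (tree: `FreeTranslations`, `ScaleRedundant`,
  `TwoPointPositivity`, `exists_pos_renormalisation` + `criticalCorr_eq_zero_of_odd`).
  `not_crux_iff`: a disproof must show that EVERY full-filter pointwise limit has `S₂ ≡ 0`.
* `euclideanLimit_iff_crux_and_rotationUpgrade`: crit-ising.S03 (`CritIsing3DEuclideanLimit`, item 0638)
  is EXACTLY the crux plus "every non-degenerate limit is, normalised, `O(3)` invariant" (some limit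
  isotropic ⟺ all are: uniqueness up to one scale).
* `limitRotationInvariant_iff`: the route's item 1980 `LimitRotationInvariant` is equivalent to
  `HRP2Rigidity →` that rotation upgrade (its normalisation / translation / scale hypotheses are idle).
* `not_euclideanLimit_of_not_crux`, `not_moebiusLimit_of_not_crux`, `not_conjunct_of_not_crux`:
  refuting the crux refutes items 0638, 1344 and the conjunct.

Reference: H. Duminil-Copin, Proc. ICM 2022, §8.4 p. 29 (existence of the scaling limits on `ℤ³` is
"widely open") [DuminilCopinICM2022].
-/

noncomputable section

namespace Summit.CriticalPhenomena.Ising3DConformalLimit.ExistsScaleCovariantLimitNegative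

open Literature.Probability.LatticeModels Filter Set
open scoped Topology
open Summit.CriticalPhenomena.Ising3DConformalLimit.Theses
open Summit.CriticalPhenomena.Ising3DConformalLimit.MoebiusLimitExistsNegative
open Classical

/-- **crux ⟺ a non-degenerate full-filter pointwise limit exists** (`ρ > 0` kept): `0 < Δ`,
normalisation, translation invariance and scale covariance are consequences of existence +
non-degeneracy. [cite: DuminilCopinICM2022, §8.4 p. 29] -/
theorem iff_limit_nondeg :
    HyperoctahedralRP.ExistsScaleCovariantLimit ↔
      ∃ (ρ : ℝ → ℝ) (S : CorrFamily 3), (∀ δ ∈ Set.Ioc (0:ℝ) 1, 0 < ρ δ) ∧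
        HasPointwiseScalingLimit (criticalCorr 3) ρ S ∧ IsNondegenerateTwoPoint S := by
  constructor
  · rintro ⟨ρ, Δ, S, hρ, -, hlim, -, hnd, -, -⟩
    exact ⟨ρ, S, hρ, hlim, hnd⟩
  · rintro ⟨ρ, S, hρ, hlim, hnd⟩
    obtain ⟨Δ, hwin, hsc⟩ := exists_scaleCovariant_normalised hρ hlim hnd
    exact ⟨ρ, Δ, fun n x => if x ∈ NonCoincident 3 n then S n x else 0, hρ, by linarith [hwin.1],
      normalised_hasLimit hlim, fun n z hz => if_neg hz, normalised_nondeg hnd,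
      isTranslationInvariant_normalised_of_limit hlim, hsc⟩

/-- A renormalisation whose rescaled pair correlator converges to a positive value is eventually
non-zero along `δ → 0⁺`. [folklore] -/
theorem eventually_rho_ne_zero {ρ : ℝ → ℝ} {S : CorrFamily 3}
    (hlim : HasPointwiseScalingLimit (criticalCorr 3) ρ S) {x : Fin 2 → EuclideanSpace ℝ (Fin 3)}
    (hx : x ∈ NonCoincident 3 2) (hpos : 0 < S 2 x) : ∀ᶠ δ in 𝓝[>] (0:ℝ), ρ δ ≠ 0 := by
  filter_upwards [((hlim 2).tendsto_at hx).eventually_const_lt hpos] with δ hδ h0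
  rw [rescaledCorrelator_apply, h0] at hδ
  simp at hδ

/-- **crux ⟺ SOME full-filter pointwise scaling limit of the critical correlators has `S₂ ≢ 0` on
non-coincident pairs** — no positivity of `ρ`, no `Δ`, no normalisation, no symmetry, non-degeneracy
at ONE pair: the crux is exactly the open existence problem and nothing else.
[cite: DuminilCopinICM2022, §8.4 p. 29] -/
theorem iff_pure_existence :
    HyperoctahedralRP.ExistsScaleCovariantLimit ↔
      ∃ (ρ : ℝ → ℝ) (S : CorrFamily 3), HasPointwiseScalingLimit (criticalCorr 3) ρ S ∧
        ∃ x ∈ NonCoincident 3 2, S 2 x ≠ 0 := by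
  rw [iff_limit_nondeg]
  constructor
  · rintro ⟨ρ, S, -, hlim, hnd⟩
    exact ⟨ρ, S, hlim, _, zero_unitVec_mem_nonCoincident one_ne_zero,
      (hnd _ (zero_unitVec_mem_nonCoincident one_ne_zero)).ne'⟩
  · rintro ⟨ρ, S, hlim, x, hx, hne⟩
    have hpos : 0 < S 2 x := lt_of_le_of_ne (limit_two_nonneg hlim hx) (Ne.symm hne)
    have hnd : IsNondegenerateTwoPoint S :=
      (isNondegenerateTwoPoint_iff_exists_pos hlim).2 ⟨x, hx, hpos⟩
    obtain ⟨ρ', hρ', hlim'⟩ := hlim.exists_pos_renormalisation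
      (fun n hn y => criticalCorr_eq_zero_of_odd (by norm_num) hn y) (eventually_rho_ne_zero hlim hx hpos)
    exact ⟨ρ', S, fun δ _ => hρ' δ, hlim', hnd⟩

/-- **What a disproof must show**: EVERY full-filter pointwise scaling limit of the critical `ℤ³`
correlators (any renormalisation whatsoever) has identically vanishing two-point function on
non-coincident pairs. [folklore] -/
theorem not_crux_iff :
    ¬ HyperoctahedralRP.ExistsScaleCovariantLimit ↔
      ∀ (ρ : ℝ → ℝ) (S : CorrFamily 3), HasPointwiseScalingLimit (criticalCorr 3) ρ S →
        ∀ x ∈ NonCoincident 3 2, S 2 x = 0 := by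
  rw [iff_pure_existence]
  push Not
  exact Iff.rfl

/-- **crit-ising.S03 ⟺ crux ∧ rotation upgrade**: on top of this crux, the Euclidean-limit item 0638
is EXACTLY the statement that every non-degenerate limit is, after normalisation, `O(3)` invariant
(some limit isotropic ⟺ all are, by `exists_scale_of_isNondegenerateTwoPoint`). [folklore] -/
theorem euclideanLimit_iff_crux_and_rotationUpgrade :
    CritIsing3DEuclideanLimit ↔ HyperoctahedralRP.ExistsScaleCovariantLimit ∧
      ∀ (ρ : ℝ → ℝ) (S : CorrFamily 3), (∀ δ ∈ Set.Ioc (0:ℝ) 1, 0 < ρ δ) →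
        HasPointwiseScalingLimit (criticalCorr 3) ρ S → IsNondegenerateTwoPoint S →
          IsRotationInvariant (fun n x => if x ∈ NonCoincident 3 n then S n x else 0) := by
  constructor
  · intro h
    obtain ⟨ρ₀, Δ₀, S₀, hρ₀, -, hlim₀, hnd₀, hE₀, -⟩ := h
    refine ⟨iff_limit_nondeg.2 ⟨ρ₀, S₀, hρ₀, hlim₀, hnd₀⟩, fun ρ S hρ hlim hnd n R x => ?_⟩
    obtain ⟨c, -, hscale⟩ :=
      hlim₀.exists_scale_of_isNondegenerateTwoPoint (by norm_num) hρ₀ hρ hlim hnd₀ hnd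
    have hiff : (fun i => R (x i)) ∈ NonCoincident 3 n ↔ x ∈ NonCoincident 3 n := by
      rw [mem_nonCoincident, mem_nonCoincident]
      exact R.injective.of_comp_iff x
    by_cases hx : x ∈ NonCoincident 3 n
    · simp only [if_pos (hiff.2 hx), if_pos hx, hscale n _ (hiff.2 hx), hscale n x hx, hE₀.2 n R x]
    · simp only [if_neg (mt hiff.1 hx), if_neg hx]
  · rintro ⟨h, hR⟩
    obtain ⟨ρ, S, hρ, hlim, hnd⟩ := iff_limit_nondeg.1 h
    obtain ⟨Δ, hwin, hsc⟩ := exists_scaleCovariant_normalised hρ hlim hnd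
    exact ⟨ρ, Δ, _, hρ, by linarith [hwin.1], normalised_hasLimit hlim, normalised_nondeg hnd,
      ⟨isTranslationInvariant_normalised_of_limit hlim, hR ρ S hρ hlim hnd⟩, hsc⟩

/-- **The route's r3 item is the rotation upgrade**: `LimitRotationInvariant` (item 1980) is
equivalent to `HRP2Rigidity →` "every non-degenerate limit is, normalised, `O(3)` invariant" — its
extra hypotheses (normalisation, translation invariance, scale covariance with some `Δ`) are free
for limits. [folklore] -/
theorem limitRotationInvariant_iff :
    HyperoctahedralRP.LimitRotationInvariant ↔ (HyperoctahedralRP.HRP2Rigidity →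
      ∀ (ρ : ℝ → ℝ) (S : CorrFamily 3), (∀ δ ∈ Set.Ioc (0:ℝ) 1, 0 < ρ δ) →
        HasPointwiseScalingLimit (criticalCorr 3) ρ S → IsNondegenerateTwoPoint S →
          IsRotationInvariant (fun n x => if x ∈ NonCoincident 3 n then S n x else 0)) := by
  constructor
  · intro hL hA ρ S hρ hlim hnd
    obtain ⟨Δ, -, hsc⟩ := exists_scaleCovariant_normalised hρ hlim hnd
    exact hL hA ρ Δ _ hρ (normalised_hasLimit hlim) (fun n z hz => if_neg hz) (normalised_nondeg hnd)
      (isTranslationInvariant_normalised_of_limit hlim) hsc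
  · intro hRU hA ρ Δ S hρ hlim hnorm hnd _ _
    have hS : (fun n x => if x ∈ NonCoincident 3 n then S n x else 0) = S := by
      funext n x
      by_cases hx : x ∈ NonCoincident 3 n
      · rw [if_pos hx]
      · rw [if_neg hx, hnorm n x hx]
    have h := hRU hA ρ S hρ hlim hnd
    rwa [hS] at h

/-- Refuting the crux refutes crit-ising.S03 (item 0638). [folklore] -/
theorem not_euclideanLimit_of_not_crux (h : ¬ HyperoctahedralRP.ExistsScaleCovariantLimit) :
    ¬ CritIsing3DEuclideanLimit := fun hE =>
  h (euclideanLimit_iff_crux_and_rotationUpgrade.1 hE).1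

/-- Refuting the crux refutes the sibling crux `MoebiusLimit` (item 1344). [folklore] -/
theorem not_moebiusLimit_of_not_crux (h : ¬ HyperoctahedralRP.ExistsScaleCovariantLimit) :
    ¬ EnergyNotSigmaSquared.MoebiusLimit := by
  rintro ⟨ρ, Δ, S, hρ, -, hlim, hnd, -⟩
  exact h (iff_limit_nondeg.2 ⟨ρ, S, hρ, hlim, hnd⟩)

/-- Refuting the crux refutes the conjunct `Ising3DConformalLimit` (all routes alike). [folklore] -/
theorem not_conjunct_of_not_crux (h : ¬ HyperoctahedralRP.ExistsScaleCovariantLimit) :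
    ¬ _root_.Ising3DConformalLimit := by
  rintro ⟨ρ, Δ, S, hρ, -, hlim, hnd, -, -⟩
  exact h (iff_limit_nondeg.2 ⟨ρ, S, hρ, hlim, hnd⟩)

/-- Continuity of every witness off the diagonals is free as well (mesh continuity). [folklore] -/
theorem continuousOn_of_witness {ρ : ℝ → ℝ} {S : CorrFamily 3}
    (hlim : HasPointwiseScalingLimit (criticalCorr 3) ρ S) (n : ℕ) :
    ContinuousOn (S n) (NonCoincident 3 n) :=
  Summit.CriticalPhenomena.Ising3DConformalLimit.LimitMeshContinuity.continuousOn_limit hlim n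

end Summit.CriticalPhenomena.Ising3DConformalLimit.ExistsScaleCovariantLimitNegative

end
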